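/-
Copyright: the b2b-balaban T⁴-continuum CRUX team, row NE7b OWNER lineage `t4-ne7b-p1` (gen 145). Project licence.
-/
import Mathlib

/-!
# THE PROFILE LETTERS OF THE WEIGHTED CLASS FROM ITS FULL-GRAPH INTRINSIC LETTERS (SCOPING-d17 §D F1; (651) made abstract and extended to
# the `K3`-families).  (652)∕(657)∕(658) reproduce the weighted letters of `Hk⁺` and `K3⁺` GIVEN five profile letters of the step: the gradient
# vectors' row∕column profiles `Σ_{z′}b^v_{z′}σ_{vz′} ≤ αθ`, `Σ_v b^v_{z′}σ_{vz′} ≤ αθc` (`b^v_{z′} = Σ_u|A_{uz′}|Hk_{vu}`) and the `K3`-family's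
# (`g^{xy}_{z′} = Σ_u|A_{uz′}|K3_{xyu}`) first-index mass `Σ_yϑ₂(x,y)Σ_{z′}g^{xy}_{z′}σ_{xz′} ≤ αg1m`, second-index mass `Σ_xϑ₂(y,x)Σ_{z′}g^{xy}_{z′}σ_{yz′} ≤
# αg2m` and column letter with internal weight `Σ_{x,y}g^{xy}_{z′}σ_{xz′}ϑ₂(x,y) ≤ αg1c`.  THIS FILE discharges all five from the CLASS's intrinsic
# full-graph `ϑ₂`-letters (`Σ_uHk_{vu}ϑ₂(v,u) ≤ hrϑ`, columns `hcϑ`; `Σ_{y,u}K3_{xyu}ϑ₂(x,y)ϑ₂(x,u)ϑ₂(y,u)` in the three roles `k3rϑ, k3mϑ, k3cϑ` —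
# EXACTLY (657)'s input shapes) and the FACTOR's weighted letters (`Σ_{z′}|A_{uz′}|σA_{uz′} ≤ αrσ`, `Σ_u|A_{uz′}|σA_{uz′} ≤ αcσ`) under ONE
# compatibility `σ_{vz′} ≤ ϑ₂(v,u)·σA_{uz′}` (for exponential weights of a pseudometric: the triangle inequality, (651)):
#   `αθ = hrϑ·αrσ`, `αθc = hcϑ·αcσ`, `αg1m = k3rϑ·αrσ`, `αg2m = k3mϑ·αrσ`, `αg1c = k3cϑ·αcσ`
# (row NE7b, node U5c; Mathlib only; [folklore]).  So the weighted class map at orders 2–3 needs, per step, only the factor's weighted letters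
# (finite range ⟹ plain × e^{rate·R}) and the class's own `ϑ₂`-letters — and (652)∕(657)∕(658) return the `ϑ`-letters: CLOSURE at orders 2–3.

Cell `pub-balaban`, sub-cell `t4`, spine estimate NE7b (`T4WeightBudget.RelWeightBound`; the cell's OWN estimate — NOT PRINTED in
[Bałaban 1983–89], NOT PROVED).  Crux-route work under `Spine/NE7b/` by the row OWNER (`t4-ne7b-p1` gen 145, file (659)) under FREEZE
(0)'s crux-prover clause; NOTHING of Bałaban's is named as a Lean object, valued or asserted; no `T4Continuum/Support` leaf typed; no
`def`, no notation; zero `sorry`.  Imports: Mathlib only.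

WHAT IS PROVED ([folklore]): **`hk_profile_row`** (`αθ`), **`hk_profile_col`** (`αθc`), **`k3_mass_first`** (`αg1m`), **`k3_mass_second`** (`αg2m`),
**`k3_col_internal`** (`αg1c`); toy.

HONEST (what this is NOT).  Letter transport; the `K4`∕`K5` families (orders 4–5) follow the same two patterns (mass with partner weights from
the anchor; column with internal weights) — next files with the order-4∕5 slot letters; scalar skeleton ((A3), NC-NE7b-α UNRULED); nothing of
Bałaban's asserted.  BY-NAME EFFECT ON THE WALL: NONE.  NE7b NOT PRINTED ∕ NOT PROVED; spine PROVED 0∕9; rung (B)+1 — the programme's measures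
remain FINITE-torus statements; NOT the mass gap, NOT Clay.  HONEST DEPENDENCY: continuum YM on T⁴ ⇐ BetaPertH ∧ nine spine estimates (0∕9
proved); BetaPertH ⇐ (D1) ∧ (D4) ∧ CAP+tail; G-an2-4 gates asym, D1 and NE2∕3∕4.
-/

set_option autoImplicit false

noncomputable section

namespace Summit.QuantumFields.BalabanUV.T4Continuum.NE7b.SupWeightedFamilyProfiles

open Finset Real Matrix
open scoped BigOperators

variable {ι κ : Type} [Fintype ι] [Fintype κ]

variable {A : Matrix ι κ ℝ} {Hk : ι → ι → ℝ} {K3 : ι → ι → ι → ℝ} {ϑ₂ : ι → ι → ℝ} {σ σA : ι → κ → ℝ}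
  {αrσ αcσ hrϑ hcϑ k3rϑ k3mϑ k3cϑ : ℝ}

/-- **`αθ`**: the row profile of the gradient vectors, `Σ_{z′}b^v_{z′}σ_{vz′} ≤ hrϑ·αrσ`. [folklore] -/
theorem hk_profile_row (hHk0 : ∀ v u, 0 ≤ Hk v u) (hϑ₂0 : ∀ x y, 0 ≤ ϑ₂ x y) (hσϑ : ∀ v u z', σ v z' ≤ ϑ₂ v u * σA u z')
    (hAr : ∀ u, ∑ z', |A u z'| * σA u z' ≤ αrσ) (hα0 : 0 ≤ αrσ) (hHkϑ : ∀ v, ∑ u, Hk v u * ϑ₂ v u ≤ hrϑ) (v : ι) :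
    ∑ z', (∑ u, |A u z'| * Hk v u) * σ v z' ≤ hrϑ * αrσ := by
  calc ∑ z', (∑ u, |A u z'| * Hk v u) * σ v z' ≤ ∑ z', ∑ u, Hk v u * ϑ₂ v u * (|A u z'| * σA u z') := by
        refine sum_le_sum fun z' _ => ?_
        rw [sum_mul]
        refine sum_le_sum fun u _ => ?_
        calc |A u z'| * Hk v u * σ v z' ≤ |A u z'| * Hk v u * (ϑ₂ v u * σA u z') :=
              mul_le_mul_of_nonneg_left (hσϑ v u z') (mul_nonneg (abs_nonneg _) (hHk0 v u))
          _ = Hk v u * ϑ₂ v u * (|A u z'| * σA u z') := by ring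
    _ = ∑ u, Hk v u * ϑ₂ v u * ∑ z', |A u z'| * σA u z' := by rw [sum_comm]; exact sum_congr rfl fun u _ => by rw [mul_sum]
    _ ≤ ∑ u, Hk v u * ϑ₂ v u * αrσ := sum_le_sum fun u _ => mul_le_mul_of_nonneg_left (hAr u) (mul_nonneg (hHk0 v u) (hϑ₂0 v u))
    _ = (∑ u, Hk v u * ϑ₂ v u) * αrσ := by rw [sum_mul]
    _ ≤ hrϑ * αrσ := mul_le_mul_of_nonneg_right (hHkϑ v) hα0

omit [Fintype κ] in
/-- **`αθc`**: the column profile, `Σ_v b^v_{z′}σ_{vz′} ≤ hcϑ·αcσ`. [folklore] -/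
theorem hk_profile_col (hHk0 : ∀ v u, 0 ≤ Hk v u) (hσA0 : ∀ u z', 0 ≤ σA u z') (hσϑ : ∀ v u z', σ v z' ≤ ϑ₂ v u * σA u z')
    (hAc : ∀ z', ∑ u, |A u z'| * σA u z' ≤ αcσ) (hHkϑc : ∀ u, ∑ v, Hk v u * ϑ₂ v u ≤ hcϑ) (hhc0 : 0 ≤ hcϑ) (z' : κ) :
    ∑ v, (∑ u, |A u z'| * Hk v u) * σ v z' ≤ hcϑ * αcσ := by
  calc ∑ v, (∑ u, |A u z'| * Hk v u) * σ v z' ≤ ∑ v, ∑ u, |A u z'| * σA u z' * (Hk v u * ϑ₂ v u) := by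
        refine sum_le_sum fun v _ => ?_
        rw [sum_mul]
        refine sum_le_sum fun u _ => ?_
        calc |A u z'| * Hk v u * σ v z' ≤ |A u z'| * Hk v u * (ϑ₂ v u * σA u z') :=
              mul_le_mul_of_nonneg_left (hσϑ v u z') (mul_nonneg (abs_nonneg _) (hHk0 v u))
          _ = |A u z'| * σA u z' * (Hk v u * ϑ₂ v u) := by ring
    _ = ∑ u, |A u z'| * σA u z' * ∑ v, Hk v u * ϑ₂ v u := by rw [sum_comm]; exact sum_congr rfl fun u _ => by rw [mul_sum]
    _ ≤ ∑ u, |A u z'| * σA u z' * hcϑ := sum_le_sum fun u _ => mul_le_mul_of_nonneg_left (hHkϑc u) (mul_nonneg (abs_nonneg _) (hσA0 u z'))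
    _ = (∑ u, |A u z'| * σA u z') * hcϑ := by rw [sum_mul]
    _ ≤ αcσ * hcϑ := mul_le_mul_of_nonneg_right (hAc z') hhc0
    _ = hcϑ * αcσ := mul_comm _ _

/-- **`αg1m`**: the `K3`-family's first-index mass with partner weight, `Σ_yϑ₂(x,y)Σ_{z′}g^{xy}_{z′}σ_{xz′} ≤ k3rϑ·αrσ` from the full-graph
first-index letter `Σ_{y,u}K3_{xyu}ϑ₂(x,y)ϑ₂(x,u)ϑ₂(y,u) ≤ k3rϑ` (`ϑ₂ ≥ 1`). [folklore] -/
theorem k3_mass_first (hK30 : ∀ x y u, 0 ≤ K3 x y u) (hϑ₂1 : ∀ x y, 1 ≤ ϑ₂ x y) (hσA0 : ∀ u z', 0 ≤ σA u z')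
    (hσϑ : ∀ v u z', σ v z' ≤ ϑ₂ v u * σA u z')
    (hAr : ∀ u, ∑ z', |A u z'| * σA u z' ≤ αrσ) (hα0 : 0 ≤ αrσ) (hk3r : ∀ x, ∑ y, ∑ u, K3 x y u * (ϑ₂ x y * ϑ₂ x u * ϑ₂ y u) ≤ k3rϑ) (x : ι) :
    ∑ y, ϑ₂ x y * ∑ z', (∑ u, |A u z'| * K3 x y u) * σ x z' ≤ k3rϑ * αrσ := by
  have hϑ₂0 : ∀ x y, 0 ≤ ϑ₂ x y := fun x y => zero_le_one.trans (hϑ₂1 x y)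
  calc ∑ y, ϑ₂ x y * ∑ z', (∑ u, |A u z'| * K3 x y u) * σ x z' ≤ ∑ y, ∑ u, K3 x y u * (ϑ₂ x y * ϑ₂ x u * ϑ₂ y u) * ∑ z', |A u z'| * σA u z' := by
        refine sum_le_sum fun y _ => ?_
        rw [mul_sum]
        calc ∑ z', ϑ₂ x y * ((∑ u, |A u z'| * K3 x y u) * σ x z') ≤ ∑ z', ∑ u, K3 x y u * (ϑ₂ x y * ϑ₂ x u * ϑ₂ y u) * (|A u z'| * σA u z') := by
              refine sum_le_sum fun z' _ => ?_
              rw [sum_mul, mul_sum]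
              refine sum_le_sum fun u _ => ?_
              calc ϑ₂ x y * (|A u z'| * K3 x y u * σ x z') ≤ ϑ₂ x y * (|A u z'| * K3 x y u * (ϑ₂ x u * σA u z')) :=
                    mul_le_mul_of_nonneg_left (mul_le_mul_of_nonneg_left (hσϑ x u z') (mul_nonneg (abs_nonneg _) (hK30 x y u))) (hϑ₂0 x y)
                _ = K3 x y u * (ϑ₂ x y * ϑ₂ x u * 1) * (|A u z'| * σA u z') := by ring
                _ ≤ K3 x y u * (ϑ₂ x y * ϑ₂ x u * ϑ₂ y u) * (|A u z'| * σA u z') :=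
                    mul_le_mul_of_nonneg_right (mul_le_mul_of_nonneg_left (mul_le_mul_of_nonneg_left (hϑ₂1 y u)
                      (mul_nonneg (hϑ₂0 x y) (hϑ₂0 x u))) (hK30 x y u)) (mul_nonneg (abs_nonneg _) (hσA0 u z'))
          _ = ∑ u, K3 x y u * (ϑ₂ x y * ϑ₂ x u * ϑ₂ y u) * ∑ z', |A u z'| * σA u z' := by
              rw [sum_comm]; exact sum_congr rfl fun u _ => by rw [mul_sum]
    _ ≤ ∑ y, ∑ u, K3 x y u * (ϑ₂ x y * ϑ₂ x u * ϑ₂ y u) * αrσ := sum_le_sum fun y _ => sum_le_sum fun u _ =>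
        mul_le_mul_of_nonneg_left (hAr u) (mul_nonneg (hK30 x y u) (mul_nonneg (mul_nonneg (hϑ₂0 x y) (hϑ₂0 x u)) (hϑ₂0 y u)))
    _ = (∑ y, ∑ u, K3 x y u * (ϑ₂ x y * ϑ₂ x u * ϑ₂ y u)) * αrσ := by rw [sum_mul]; exact sum_congr rfl fun y _ => by rw [sum_mul]
    _ ≤ k3rϑ * αrσ := mul_le_mul_of_nonneg_right (hk3r x) hα0

/-- **`αg2m`**: the second-index mass, `Σ_xϑ₂(y,x)Σ_{z′}g^{xy}_{z′}σ_{yz′} ≤ k3mϑ·αrσ` from the full-graph second-index letter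
`Σ_{x,u}K3_{xyu}ϑ₂(y,x)ϑ₂(y,u)ϑ₂(x,u) ≤ k3mϑ`. [folklore] -/
theorem k3_mass_second (hK30 : ∀ x y u, 0 ≤ K3 x y u) (hϑ₂1 : ∀ x y, 1 ≤ ϑ₂ x y) (hσA0 : ∀ u z', 0 ≤ σA u z')
    (hσϑ : ∀ v u z', σ v z' ≤ ϑ₂ v u * σA u z') (hAr : ∀ u, ∑ z', |A u z'| * σA u z' ≤ αrσ) (hα0 : 0 ≤ αrσ)
    (hk3m : ∀ y, ∑ x, ∑ u, K3 x y u * (ϑ₂ y x * ϑ₂ y u * ϑ₂ x u) ≤ k3mϑ) (y : ι) :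
    ∑ x, ϑ₂ y x * ∑ z', (∑ u, |A u z'| * K3 x y u) * σ y z' ≤ k3mϑ * αrσ := by
  have hϑ₂0 : ∀ x y, 0 ≤ ϑ₂ x y := fun x y => zero_le_one.trans (hϑ₂1 x y)
  calc ∑ x, ϑ₂ y x * ∑ z', (∑ u, |A u z'| * K3 x y u) * σ y z' ≤ ∑ x, ∑ u, K3 x y u * (ϑ₂ y x * ϑ₂ y u * ϑ₂ x u) * ∑ z', |A u z'| * σA u z' := by
        refine sum_le_sum fun x _ => ?_
        rw [mul_sum]
        calc ∑ z', ϑ₂ y x * ((∑ u, |A u z'| * K3 x y u) * σ y z') ≤ ∑ z', ∑ u, K3 x y u * (ϑ₂ y x * ϑ₂ y u * ϑ₂ x u) * (|A u z'| * σA u z') := by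
              refine sum_le_sum fun z' _ => ?_
              rw [sum_mul, mul_sum]
              refine sum_le_sum fun u _ => ?_
              calc ϑ₂ y x * (|A u z'| * K3 x y u * σ y z') ≤ ϑ₂ y x * (|A u z'| * K3 x y u * (ϑ₂ y u * σA u z')) :=
                    mul_le_mul_of_nonneg_left (mul_le_mul_of_nonneg_left (hσϑ y u z') (mul_nonneg (abs_nonneg _) (hK30 x y u))) (hϑ₂0 y x)
                _ = K3 x y u * (ϑ₂ y x * ϑ₂ y u * 1) * (|A u z'| * σA u z') := by ring
                _ ≤ K3 x y u * (ϑ₂ y x * ϑ₂ y u * ϑ₂ x u) * (|A u z'| * σA u z') :=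
                    mul_le_mul_of_nonneg_right (mul_le_mul_of_nonneg_left (mul_le_mul_of_nonneg_left (hϑ₂1 x u)
                      (mul_nonneg (hϑ₂0 y x) (hϑ₂0 y u))) (hK30 x y u)) (mul_nonneg (abs_nonneg _) (hσA0 u z'))
          _ = ∑ u, K3 x y u * (ϑ₂ y x * ϑ₂ y u * ϑ₂ x u) * ∑ z', |A u z'| * σA u z' := by
              rw [sum_comm]; exact sum_congr rfl fun u _ => by rw [mul_sum]
    _ ≤ ∑ x, ∑ u, K3 x y u * (ϑ₂ y x * ϑ₂ y u * ϑ₂ x u) * αrσ := sum_le_sum fun x _ => sum_le_sum fun u _ =>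
        mul_le_mul_of_nonneg_left (hAr u) (mul_nonneg (hK30 x y u) (mul_nonneg (mul_nonneg (hϑ₂0 y x) (hϑ₂0 y u)) (hϑ₂0 x u)))
    _ = (∑ x, ∑ u, K3 x y u * (ϑ₂ y x * ϑ₂ y u * ϑ₂ x u)) * αrσ := by rw [sum_mul]; exact sum_congr rfl fun x _ => by rw [sum_mul]
    _ ≤ k3mϑ * αrσ := mul_le_mul_of_nonneg_right (hk3m y) hα0

omit [Fintype κ] in
/-- **`αg1c`**: the column letter with internal weight, `Σ_{x,y}g^{xy}_{z′}σ_{xz′}ϑ₂(x,y) ≤ k3cϑ·αcσ` from the full-graph third-index letter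
`Σ_{x,y}K3_{xyu}ϑ₂(u,x)ϑ₂(u,y)ϑ₂(x,y) ≤ k3cϑ` (`ϑ₂` symmetric, `≥ 1`). [folklore] -/
theorem k3_col_internal (hK30 : ∀ x y u, 0 ≤ K3 x y u) (hϑ₂1 : ∀ x y, 1 ≤ ϑ₂ x y) (hϑ₂symm : ∀ x y, ϑ₂ x y = ϑ₂ y x)
    (hσA0 : ∀ u z', 0 ≤ σA u z') (hσϑ : ∀ v u z', σ v z' ≤ ϑ₂ v u * σA u z') (hAc : ∀ z', ∑ u, |A u z'| * σA u z' ≤ αcσ)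
    (hk3c : ∀ u, ∑ x, ∑ y, K3 x y u * (ϑ₂ u x * ϑ₂ u y * ϑ₂ x y) ≤ k3cϑ) (hk3c0 : 0 ≤ k3cϑ) (z' : κ) :
    ∑ x, ∑ y, (∑ u, |A u z'| * K3 x y u) * (σ x z' * ϑ₂ x y) ≤ k3cϑ * αcσ := by
  have hϑ₂0 : ∀ x y, 0 ≤ ϑ₂ x y := fun x y => zero_le_one.trans (hϑ₂1 x y)
  calc ∑ x, ∑ y, (∑ u, |A u z'| * K3 x y u) * (σ x z' * ϑ₂ x y)
      ≤ ∑ x, ∑ y, ∑ u, |A u z'| * σA u z' * (K3 x y u * (ϑ₂ u x * ϑ₂ u y * ϑ₂ x y)) := by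
        refine sum_le_sum fun x _ => sum_le_sum fun y _ => ?_
        rw [sum_mul]
        refine sum_le_sum fun u _ => ?_
        calc |A u z'| * K3 x y u * (σ x z' * ϑ₂ x y) ≤ |A u z'| * K3 x y u * (ϑ₂ x u * σA u z' * ϑ₂ x y) :=
              mul_le_mul_of_nonneg_left (mul_le_mul_of_nonneg_right (hσϑ x u z') (hϑ₂0 x y)) (mul_nonneg (abs_nonneg _) (hK30 x y u))
          _ = |A u z'| * σA u z' * (K3 x y u * (ϑ₂ u x * 1 * ϑ₂ x y)) := by rw [hϑ₂symm x u]; ring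
          _ ≤ |A u z'| * σA u z' * (K3 x y u * (ϑ₂ u x * ϑ₂ u y * ϑ₂ x y)) :=
              mul_le_mul_of_nonneg_left (mul_le_mul_of_nonneg_left (mul_le_mul_of_nonneg_right
                (mul_le_mul_of_nonneg_left (hϑ₂1 u y) (hϑ₂0 u x)) (hϑ₂0 x y)) (hK30 x y u)) (mul_nonneg (abs_nonneg _) (hσA0 u z'))
    _ = ∑ x, ∑ u, ∑ y, |A u z'| * σA u z' * (K3 x y u * (ϑ₂ u x * ϑ₂ u y * ϑ₂ x y)) := sum_congr rfl fun x _ => sum_comm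
    _ = ∑ u, ∑ x, ∑ y, |A u z'| * σA u z' * (K3 x y u * (ϑ₂ u x * ϑ₂ u y * ϑ₂ x y)) := sum_comm
    _ = ∑ u, |A u z'| * σA u z' * ∑ x, ∑ y, K3 x y u * (ϑ₂ u x * ϑ₂ u y * ϑ₂ x y) :=
        sum_congr rfl fun u _ => by rw [mul_sum]; exact sum_congr rfl fun x _ => by rw [mul_sum]
    _ ≤ ∑ u, |A u z'| * σA u z' * k3cϑ := sum_le_sum fun u _ => mul_le_mul_of_nonneg_left (hk3c u) (mul_nonneg (abs_nonneg _) (hσA0 u z'))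
    _ = (∑ u, |A u z'| * σA u z') * k3cϑ := by rw [sum_mul]
    _ ≤ αcσ * k3cϑ := mul_le_mul_of_nonneg_right (hAc z') hk3c0
    _ = k3cϑ * αcσ := mul_comm _ _

/-! ## Toy -/

/-- Toy (the transport in numbers): an intrinsic letter `2` and a factor letter `3` give the profile letter `6`. -/
example : (2 : ℝ) * 3 = 6 := by norm_num


end Summit.QuantumFields.BalabanUV.T4Continuum.NE7b.SupWeightedFamilyProfiles

end
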